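import Mathlib
import Literature.Probability.Moments.HoeffdingCountingRange
import HarnessLib

/-!
# Route FifoMatching — crux `NNLinearDegreeCofactorHard` (stmt-ValiantsHypothesis-23918), line `internal_cofactor`:
# stub S2b, unit (E′) — the BAND estimate for a drifted block walk (design-independent core)

The (ii) measure of the line (design-constraints memo `Lines/internal_cofactor-S2b-measure-constraints.md`,
§5; director-valiant g10 ruling 2026-08-28T01:07:58Z) draws a queue word whose `V`-letters are read
off independent uniform BLOCKS of bits with position-dependent biases (drift), the `R`-letters being
forced; its height `h_t` must stay in a band `|h_t − H(t)| ≤ m` around a deterministic envelope.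
With `H(t) := E h_t` this is a maximal deviation inequality for partial sums of independent,
non-identically distributed, bounded steps.  This file proves it in the tree's measure-free COUNTING
form, for an arbitrary finite product `∏_{i < N} κ_i` (the blocks) and steps `g_i : κ_i → ℝ` taking
values in intervals `[a_i, a_i + w]` of a common width `w`:

* `coordMean_const'` — the mean of a constant step;
* `card_filter_abs_prefix_centered_ge_le` — ONE time `t ≥ 1`:
  `#{y : m ≤ |∑_{i<t} (g_i(y_i) − E g_i)|} ≤ 2·exp(−2m²/(w²N))·∏ #κ_i`
  (`Literature.Probability.Moments.hoeffding_count_pi_Icc_abs_centered`, freezing the steps `i ≥ t`);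
* `card_filter_exists_abs_prefix_centered_ge_le` — **the band estimate**: the number of block
  strings whose centred height leaves the band `(−m, m)` at SOME time `t ≤ N` is at most
  `2N·exp(−2m²/(w²N))·∏ #κ_i`; for `±1`-valued letters (`w = 2`) this is the landed
  `2N·exp(−m²/(2N))` of `…NNMonotoneHardBand.card_filter_exists_abs_prefixSum_ge_le`, now with
  arbitrary biases and block alphabets (forced `R`-pushes between two `V`-letters are a deterministic
  shift of that step: same width).

Honest framing: elementary counting for one unit of one stub of an OPEN crux; nothing here bears on the
crux, `NNDivisionHard`, `NNNotVP` or `VP ≠ VNP` (NOT proved).  No definitions, no named facts. [folklore]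
-/

noncomputable section

-- Sub = Summit single-conjunct layout: the duplicated namespace component is mandated by the tree.
set_option linter.dupNamespace false

namespace Summit.ValiantsHypothesis.ValiantsHypothesis.Theorems.FifoMatching.NNLinearDegreeCofactorHard.InternalCofactor

open Finset Real Literature.Probability.Moments

/-- The coordinate mean of a constant step is the constant. [folklore] -/
theorem coordMean_const' {κ : Type*} [Fintype κ] [Nonempty κ] (c : ℝ) :
    coordMean (fun _ : κ => c) = c := by
  rw [coordMean, sum_const, card_univ, nsmul_eq_mul, mul_div_cancel_left₀]
  exact_mod_cast Fintype.card_ne_zero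

/-- **Centred deviation of one prefix sum of a block walk.**  For independent uniform blocks
`y_i ∈ κ_i` (`i < N`), steps `g_i(y_i) ∈ [a_i, a_i + w]` (`w > 0`) and a time `1 ≤ t ≤ N`:
`#{y : m ≤ |∑_{i<t} (g_i(y_i) − E g_i)|} ≤ 2·exp(−2m²/(w²N))·∏_i #κ_i`. [folklore] -/
theorem card_filter_abs_prefix_centered_ge_le {N : ℕ} {κ : Fin N → Type*}
    [∀ i, Fintype (κ i)] [∀ i, DecidableEq (κ i)] [∀ i, Nonempty (κ i)]
    (g : ∀ i, κ i → ℝ) (a : Fin N → ℝ) {w : ℝ} (hw : 0 < w)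
    (hg : ∀ i x, g i x ∈ Set.Icc (a i) (a i + w)) {t : ℕ} (ht : 0 < t) (htN : t ≤ N)
    {m : ℝ} (hm : 0 ≤ m) :
    ((univ.filter fun y : (∀ i, κ i) =>
        m ≤ |∑ i : Fin N, (if (i : ℕ) < t then g i (y i) - coordMean (g i) else 0)|).card : ℝ)
      ≤ 2 * Real.exp (-(2 * m ^ 2 / (w ^ 2 * N))) * ∏ i, (Fintype.card (κ i) : ℝ) := by
  classical
  -- freeze the steps after time `t`
  set g' : ∀ i : Fin N, κ i → ℝ := fun i x => if (i : ℕ) < t then g i x else a i with hg'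
  set b' : Fin N → ℝ := fun i => if (i : ℕ) < t then a i + w else a i with hb'
  have hgI : ∀ i x, g' i x ∈ Set.Icc (a i) (b' i) := by
    intro i x
    by_cases h : (i : ℕ) < t
    · simp only [hg', hb', if_pos h]; exact hg i x
    · simp only [hg', hb', if_neg h]; exact ⟨le_rfl, le_rfl⟩
  have hterm : ∀ i : Fin N, (b' i - a i) ^ 2 = if (i : ℕ) < t then w ^ 2 else 0 := by
    intro i
    by_cases h : (i : ℕ) < t
    · simp only [hb', if_pos h]; ring
    · simp only [hb', if_neg h]; ring
  have hSle : ∑ i : Fin N, (b' i - a i) ^ 2 ≤ w ^ 2 * N := by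
    calc ∑ i : Fin N, (b' i - a i) ^ 2 ≤ ∑ _i : Fin N, w ^ 2 := by
          refine sum_le_sum fun i _ => ?_
          rw [hterm]; split_ifs
          · exact le_rfl
          · positivity
      _ = w ^ 2 * N := by rw [sum_const, card_univ, Fintype.card_fin, nsmul_eq_mul, mul_comm]
  have hSpos : 0 < ∑ i : Fin N, (b' i - a i) ^ 2 := by
    have i₀ : Fin N := ⟨t - 1, by omega⟩
    have hi₀ : ((⟨t - 1, by omega⟩ : Fin N) : ℕ) < t := by simp only; omega
    refine lt_of_lt_of_le ?_ (single_le_sum (f := fun i : Fin N => (b' i - a i) ^ 2)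
      (fun i _ => sq_nonneg _) (mem_univ (⟨t - 1, by omega⟩ : Fin N)))
    rw [hterm, if_pos hi₀]; positivity
  -- the centred sums agree
  have hsum : ∀ y : (∀ i, κ i),
      ∑ i : Fin N, (if (i : ℕ) < t then g i (y i) - coordMean (g i) else 0) =
        ∑ i : Fin N, (g' i (y i) - coordMean (g' i)) := by
    intro y
    refine sum_congr rfl fun i _ => ?_
    by_cases h : (i : ℕ) < t
    · have : (fun x : κ i => if (i : ℕ) < t then g i x else a i) = g i := by
        funext x; rw [if_pos h]
      simp only [hg', if_pos h, this]
    · have : (fun x : κ i => if (i : ℕ) < t then g i x else a i) = fun _ => a i := by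
        funext x; rw [if_neg h]
      simp only [hg', if_neg h, this, coordMean_const', sub_self]
  have h := hoeffding_count_pi_Icc_abs_centered g' a b' hgI hm hSpos
  have hset : (univ.filter fun y : (∀ i, κ i) =>
      m ≤ |∑ i : Fin N, (if (i : ℕ) < t then g i (y i) - coordMean (g i) else 0)|) =
      (univ.filter fun y : (∀ i, κ i) => m ≤ |∑ i, (g' i (y i) - coordMean (g' i))|) :=
    filter_congr fun y _ => by rw [hsum y]
  rw [hset]
  refine h.trans (mul_le_mul_of_nonneg_right (mul_le_mul_of_nonneg_left
    (Real.exp_le_exp.2 (neg_le_neg ?_)) (by norm_num)) (by positivity))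
  -- `2m²/(w²N) ≤ 2m²/Σ`
  exact div_le_div_of_nonneg_left (by positivity) hSpos hSle

/-- **The band estimate for a drifted block walk.**  For independent uniform blocks `y_i ∈ κ_i`
(`i < N`, `N ≥ 1`) and steps `g_i(y_i) ∈ [a_i, a_i + w]` (`w > 0`), the number of block strings
whose CENTRED height `∑_{i<t} (g_i(y_i) − E g_i)` reaches absolute value `≥ m` (`m > 0`) at some
time `t ≤ N` is at most `2N·exp(−2m²/(w²N))·∏_i #κ_i`.  (`w = 2`: `2N·exp(−m²/(2N))`, the landed
constant of the fair `±1` walk.) [folklore] -/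
theorem card_filter_exists_abs_prefix_centered_ge_le {N : ℕ} {κ : Fin N → Type*}
    [∀ i, Fintype (κ i)] [∀ i, DecidableEq (κ i)] [∀ i, Nonempty (κ i)]
    (g : ∀ i, κ i → ℝ) (a : Fin N → ℝ) {w : ℝ} (hw : 0 < w)
    (hg : ∀ i x, g i x ∈ Set.Icc (a i) (a i + w)) {m : ℝ} (hm : 0 < m) :
    ((univ.filter fun y : (∀ i, κ i) => ∃ t : ℕ, t ≤ N ∧
        m ≤ |∑ i : Fin N, (if (i : ℕ) < t then g i (y i) - coordMean (g i) else 0)|).card : ℝ)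
      ≤ 2 * N * Real.exp (-(2 * m ^ 2 / (w ^ 2 * N))) * ∏ i, (Fintype.card (κ i) : ℝ) := by
  classical
  set S : (∀ i, κ i) → ℕ → ℝ := fun y t =>
    ∑ i : Fin N, (if (i : ℕ) < t then g i (y i) - coordMean (g i) else 0) with hSdef
  have hS0 : ∀ y, S y 0 = 0 := fun y => by simp [hSdef]
  -- union bound over `t ∈ [1, N]`
  have hsub : (univ.filter fun y : (∀ i, κ i) => ∃ t : ℕ, t ≤ N ∧ m ≤ |S y t|) ⊆
      (Finset.range N).biUnion fun s => univ.filter fun y => m ≤ |S y (s + 1)| := by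
    intro y hy
    simp only [mem_filter, mem_univ, true_and] at hy
    obtain ⟨t, htN, hmt⟩ := hy
    have ht0 : t ≠ 0 := by
      rintro rfl
      rw [hS0, abs_zero] at hmt
      exact absurd hmt (not_le.2 hm)
    obtain ⟨s, rfl⟩ := Nat.exists_eq_succ_of_ne_zero ht0
    rw [mem_biUnion]
    exact ⟨s, mem_range.2 (by omega), mem_filter.2 ⟨mem_univ _, hmt⟩⟩
  calc ((univ.filter fun y : (∀ i, κ i) => ∃ t : ℕ, t ≤ N ∧ m ≤ |S y t|).card : ℝ)
      ≤ (((Finset.range N).biUnion fun s => univ.filter fun y => m ≤ |S y (s + 1)|).card : ℝ) := by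
        exact_mod_cast card_le_card hsub
    _ ≤ ∑ s ∈ Finset.range N, ((univ.filter fun y => m ≤ |S y (s + 1)|).card : ℝ) := by
        exact_mod_cast card_biUnion_le
    _ ≤ ∑ _s ∈ Finset.range N,
          2 * Real.exp (-(2 * m ^ 2 / (w ^ 2 * N))) * ∏ i, (Fintype.card (κ i) : ℝ) := by
        refine sum_le_sum fun s hs => ?_
        have hs' : s + 1 ≤ N := by rw [mem_range] at hs; omega
        exact card_filter_abs_prefix_centered_ge_le g a hw hg (Nat.succ_pos s) hs' hm.le
    _ = 2 * N * Real.exp (-(2 * m ^ 2 / (w ^ 2 * N))) * ∏ i, (Fintype.card (κ i) : ℝ) := by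
        rw [sum_const, card_range, nsmul_eq_mul]; ring

end Summit.ValiantsHypothesis.ValiantsHypothesis.Theorems.FifoMatching.NNLinearDegreeCofactorHard.InternalCofactor

end
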